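import Summits.ResolutionOfSingularities.ResolutionOfSingularities.Theses.FrobeniusLadder
import Summits.ResolutionOfSingularities.ResolutionOfSingularities.Theorems.FrobeniusLadderFInjectiveMacaulayficationTrFullStepDoor
import Summits.ResolutionOfSingularities.ResolutionOfSingularities.Theorems.FrobeniusLadderFInjectiveMacaulayficationOfTrRungs
import HarnessLib

/-!
# v41 «FULL-TO-REGULAR DOOR» — AUDIT TWINS (companion of `Lines/step_door.lean`; sorry-free; res-L1-w45a-stub-3 g9)

[OURS · L1 W4.5a] Companion file: the two directions of the calibration between v41's residue and v40's / v38's, with the stubs' statements taken as HYPOTHESES (no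
`sorry`). AI-written (AI review is weaker than expert review).
* `FInjectiveMacaulayfication_of_v40_residue` — v40's T_FULL-stub IMPLIES v41's step-stub by `TrFullStep.tStep_of_trFull` (restriction + weakening; v41 is the kernel-weakest
  letter), then v41's assembly.
* `FInjectiveMacaulayfication_of_v38_residue` — v38's T-stub ⇒ v40's (`TrFull.trFull_of_tr`) ⇒ v41's, then v41's assembly.
* `FInjectiveMacaulayfication_via_v38` — CONVERSE modulo the prints, Česnavičius (B) and the F-half: v41's step-stub gives back ResolutionFullTr at every level
  (`TrFullStepDoor.resolutionFullTr_le_of_prints_of_F_of_tStep`), hence v38's T-rungs (`TrOfResolutionFull.tr_le_of_cesnaviciusOffClosed_of_F_of_resolutionFull`), hence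
  the crux by v38's own assembly `OfTrRungs.fInjectiveMacaulayfication_of_trRungs_of_cesnaviciusOffClosed` — the square closes.
-/

-- single-problem summit: the doubled namespace component is forced
set_option linter.dupNamespace false

noncomputable section

namespace Summit.ResolutionOfSingularities.ResolutionOfSingularities.Cruxes.FInjectiveMacaulayfication.StepDoorTwins

open AlgebraicGeometry CategoryTheory Literature.AlgebraicGeometry.Resolution
open Summit.ResolutionOfSingularities.ResolutionOfSingularities.Theorems.FInjectiveMacaulayfication

/-- AUDIT TWIN 1: v40's residue (T_FULL at `r = 1`) ⇒ v41's step-stub by `tStep_of_trFull`, then v41's assembly. [OURS · plumbing; v41] -/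
theorem FInjectiveMacaulayfication_of_v40_residue
    (hF : CossartPiltant2019General.{0} ∧ Stacks081R.{0} ∧ CossartPiltant2019Principalization.{0} ∧ CesnaviciusBlowupMacaulayficationOffClosed.{0})
    (hTF1 : ∀ p e : ℕ, p.Prime → 4 ≤ e → TrFull.ClosedPointLocalResolutionFullTr p e 1)
    (hFadm : LocalFullificationFibreAdmGe4Split.LocalFInjectivizationFibreAdmGe4) :
    Summit.ResolutionOfSingularities.ResolutionOfSingularities.Theses.FrobeniusLadder.FInjectiveMacaulayfication :=
  TrFullStepDoor.fInjectiveMacaulayfication_of_prints_of_LFadmF_of_tStepOne hF.1 hF.2.1 hF.2.2.1 hF.2.2.2 hFadm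
    fun p e hp he => TrFullStep.tStep_of_trFull (hTF1 p e hp he)

/-- AUDIT TWIN 2: v38's residue (T at `r = 1`) ⇒ v40's ⇒ v41's, then v41's assembly. [OURS · plumbing; v41] -/
theorem FInjectiveMacaulayfication_of_v38_residue
    (hF : CossartPiltant2019General.{0} ∧ Stacks081R.{0} ∧ CossartPiltant2019Principalization.{0} ∧ CesnaviciusBlowupMacaulayficationOffClosed.{0})
    (hT1 : ∀ p e : ℕ, p.Prime → 4 ≤ e → ClosedPointLocalResolutionAdmTr.ClosedPointLocalResolutionAdmTr p e 1)
    (hFadm : LocalFullificationFibreAdmGe4Split.LocalFInjectivizationFibreAdmGe4) :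
    Summit.ResolutionOfSingularities.ResolutionOfSingularities.Theses.FrobeniusLadder.FInjectiveMacaulayfication :=
  FInjectiveMacaulayfication_of_v40_residue hF (fun p e hp he => TrFull.trFull_of_tr (hT1 p e hp he)) hFadm

/-- AUDIT TWIN 3 (CONVERSE modulo prints ∧ Česnavičius (B) ∧ F-half): v41's step-stub ⇒ v38's T-rungs at every level ⇒ the crux by v38's assembly — the square closes.
[OURS · plumbing; v41] -/
theorem FInjectiveMacaulayfication_via_v38
    (hF : CossartPiltant2019General.{0} ∧ Stacks081R.{0} ∧ CossartPiltant2019Principalization.{0} ∧ CesnaviciusBlowupMacaulayficationOffClosed.{0})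
    (hT1 : ∀ p e : ℕ, p.Prime → 4 ≤ e → TrFullStep.LocalRegularizationFibreFullTr p e 1)
    (hFadm : LocalFullificationFibreAdmGe4Split.LocalFInjectivizationFibreAdmGe4) :
    Summit.ResolutionOfSingularities.ResolutionOfSingularities.Theses.FrobeniusLadder.FInjectiveMacaulayfication :=
  OfTrRungs.fInjectiveMacaulayfication_of_trRungs_of_cesnaviciusOffClosed hF.1 hF.2.1 hF.2.2.1 hF.2.2.2
    (fun p e r hp he hr =>
      TrOfResolutionFull.tr_le_of_cesnaviciusOffClosed_of_F_of_resolutionFull e hF.1 hF.2.1 hF.2.2.1 hF.2.2.2 hp (fun e' h4 _ => hFadm e' h4 p hp)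
        (TrFullStepDoor.resolutionFullTr_le_of_prints_of_F_of_tStep e hF.1 hF.2.1 hF.2.2.1 hF.2.2.2 hp (fun e' h4 _ => hFadm e' h4 p hp)
          (fun e' r' h4' _ hr' => TrFullStep.forall_tStep_of_one (hT1 p e' hp h4') r' hr'))
        e r he le_rfl hr)
    hFadm

end Summit.ResolutionOfSingularities.ResolutionOfSingularities.Cruxes.FInjectiveMacaulayfication.StepDoorTwins

end
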